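import Summits.QuantumFields.BalabanUV.Beta.FP.TorusCompositeObjectsG
import Summits.QuantumFields.BalabanUV.Beta.FP.TorusSymGaugeCovariance
import Summits.QuantumFields.BalabanUV.Beta.GAN24.SymLinKernelExpansion

/-!
# `BalabanUV.Beta.FP.TorusCompositeRowsSymPeriodic` — road «FP» for binder row D1, ROUTE T, (β1) RE-BASING (ROW RULING R-D1-g52-1 (3)(c)) — **THE
# (0.4)-SYMMETRISED ONE-STEP ROWS `QstepSym` ACT ON PERIODIC 1-FORMS AS an1's SYMMETRISED LINEAR AVERAGING KERNEL `symLinKerAt` AT THE CENTRED ROOT**: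
# `Σ_q QstepSym Lc M ℓ (x, κ) q · B q.2 q.1 = stepScale d Lc ℓ · Lc^{d+1} · Σ'_z Σ_l symLinKerAt (ctr (d+1) Lc) Lc κ x (l, z) · B l z = (stepScale d Lc ℓ ∕ (d+1)!) ·
# symLinAvgAt (ctr (d+1) Lc) B Lc κ x` — the sym twin of R-1 §1 `TorusCompositeRowsPeriodic.sum_Qstep_mul_periodic` (the order-0 one-step junction the sym passes
# of R-1 ∕ R-7 ∕ R-15 read BY NAME; leaf-02 g32 Q-leaf02-g32-1, journal l.58472)

WHY.  R-1 reads the ROOTED one-step rows `Qstep Lc M ℓ r` on a `fine Lc M`-periodic form as `stepScale d Lc ℓ ·` an1's rooted linear averaging `linAvgAt (toSite r)`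
(bond-count representation).  The (β1) tower's one-step rows are leaf-06 G-0's `QstepSym Lc M ℓ` = the periodised shifted straight spread `bhKStepSh d Lc (Dsh Lc) ℓ`
on ((coarse multiplier slots at `coarsePt`, `inr`), (fine field slots, `inl`)); on the `(inr, inl)` block that kernel is `stepScale d Lc ℓ · Lc^{d+1} · linSym04At
(ctr (d+1) Lc) Lc` (my g18 `PeriodisedSymBorderIndexWard.bhKStepSh_Dsh_inr_inl`), whose entries at a coarse multiplier site are an1's `symLinKerAt (ctr (d+1) Lc) Lc`
(`DshAn1.linSym04At_inr_inl` + `SymAveragingWardRootedStencils.lin04KerAt_eq_symLinKerAt`); and gan24-leaf-02's `SymLinKernelExpansion.tsum_sum_symLinKerAt_mul`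
reads the `symLinKerAt`-pairing of ANY 1-form as `((d+1)!·Lc^{d+1})⁻¹ · symLinAvgAt`.  This file assembles the torus identity (box × period lattice = lattice).

WHAT (generic `d`; blocking `Lc`, `[NeZero Lc]`; `B` a `fine Lc M`-periodic real 1-form; `x ∈ pbox M`, `κ`).
* §1 `sum_perZ_mul_periodic` — a PRIVATE verbatim copy of R-5 §1's kernel-generic engine (torus pairing with a periodic form = lattice pairing), DISCLOSED as in
  R-18 ∕ R-19 (R-5 `FP.TorusStepInsertionPeriodic` p370150 ✓ has no farm olean at the time of writing; de-duplicated by `import` once the lane serves).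
* §2 `QstepSym_apply` (the rows entrywise: `perZ (fine Lc M) (bhKStepSh d Lc (Dsh Lc) ℓ) (Lc•x) q.1 (inr κ) (inl q.2)`), `bhKStepSh_Dsh_zsmul_inr_inl` (at a coarse
  multiplier site `Lc•x` the `(inr κ, inl l)` entry is `stepScale d Lc ℓ · Lc^{d+1} · symLinKerAt (ctr (d+1) Lc) Lc κ x (l, z)`), **`sum_QstepSym_mul_periodic (ℓ) (B) (hB)
  (x κ) : Σ_q QstepSym Lc M ℓ (x, κ) q · B q.2 q.1 = stepScale d Lc ℓ · Lc^{d+1} · Σ'_z Σ_l symLinKerAt (ctr (d+1) Lc) Lc κ x (l, z) · B l z`** (kernel form), and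
  **`sum_QstepSym_mul_periodic_eq_symLinAvgAt`**: `… = stepScale d Lc ℓ · ((d+1)! : ℝ)⁻¹ · symLinAvgAt (ctr (d+1) Lc) B Lc κ x` (average form).
* §3 THE COMPOSITE, CARRIER-FREE (R-7's architecture): for ANY functional `𝓡 lev n : Form1 → Form1` obeying OUR top-peeled recursion — `h0 : 𝓡 lev 0 B = B`,
  `hsucc : 𝓡 lev (n+1) B κ x = stepScale d Lc (lev 1) · (Lc^{d+1} · Σ'_z Σ_l symLinKerAt (ctr (d+1) Lc) Lc κ x (l, z) · 𝓡 (lev ∘ succ) n B l z)` — and mapping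
  finest-periodic forms to top-periodic forms (`hper`), **`sum_compRowsSym_mul_periodic_of_clauses : Σ_q compRowsSym Lc M lev rs n (x, κ) q · A q.2 q.1 = 𝓡 lev n A κ x`**
  for every `towerTorus Lc M n`-periodic `A` (induction: `compRowsSym_succ` on the torus side, `hsucc` on the lattice side, §2 at the top).  The lattice CARRIER
  (Q-leaf02-g32-1: a lattice composite of `symLinAvgAt`, or the kernel functional of an2's F3 `compLinKer` at the sym bricks) instantiates `𝓡` by its clauses.
NOT HERE: that instantiation; any chart; any estimate.  [folklore] finite sums ∕ finitely supported `tsum`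
re-indexing BY NAME over OUR bookkeeping objects (`QstepSym ∕ perF ∕ perZ ∕ coarsePt`) and an1's typed tables (`bhKStepSh ∕ Dsh ∕ linSym04At ∕ symLinKerAt ∕ symLinAvgAt`);
no `def`, no `def … : Prop`, nothing cited, 0 sorry, default heartbeats.  Nothing of the dictionary ∕ Bałaban's non-linear averages asserted (that the (β1) one-step
rows ARE the record's symmetrised averaging's linearisation is ROOT M‴'s ∕ the ROW's (β1) ruling, quoted); NO chart fixed; the (C1) TABLES, the seven letters,
`hH ∕ hQ` untouched.

HONEST DEPENDENCY (page 1, mandatory): continuum YM on T⁴ ⇐ BetaPertH ∧ nine spine estimates (0/9 proved); BetaPertH ⇐ (D1) ∧ (D4) ∧ CAP+tail;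
G-an2-4 gates asym, D1 and NE2/3/4.  HONEST FRAMING (cell contract, verbatim): «discharging `BetaPertH` makes Bałaban's UV stability UNCONDITIONAL —
a real constructive-QFT result; it is NOT the continuum limit and NOT the Clay problem.»  ABSOLUTE RULE (cell charter, verbatim): «No internally-minted
statement may enter as a cited fact. Every hypothesis is either kernel-proved in this package or a verbatim quotation of a PUBLISHED theorem with page
reference. The manuscript(s) under audit are NOT citable for their own disputed steps — they are the thing under adjudication; programme-internal
(2001/route/tribunal) claims are never citable.»  0 estimates; 0∕4 row-D1 binders (hW, hR, D1Tel, D1Rep); NOT (T-ID), NOT (C1), NOT SDF, NOT D1,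
NOT BetaPertH, NOT continuum, NOT Clay.  D1 formalisation swarm LEAF PROVER 02 (b2b-balaban-beta-d1-formalise-leaf-02 gen 32), 2026-08-24.  No existing file touched.
-/

noncomputable section

open scoped BigOperators Nat

namespace Summit.QuantumFields.BalabanUV.Beta.FP.TorusCompositeRowsSymPeriodic

open Matrix Finset
open Literature.Probability.LatticeModels (Torus.proj)
open Literature.MathematicalPhysics.QuantumFieldTheory
open Literature.MathematicalPhysics.QuantumFieldTheory.Balaban1983to89
open Literature.MathematicalPhysics.QuantumFieldTheory.Balaban1983to89.Beta
open B5Prop11Plancherel (fine)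
open B6Lemma24Torus (pbox mem_pbox)
open B4TorusKernel.MultiPeriod (translate translate_apply translate_injective)
open ExpKernelCalculus (MKer)
open AffineAveraging (Site Form1 box toSite)
open AveragingContours (off blk)
open AveragingContoursRooted (ctr ctrOff ctrOff_mem_box)
open OneStepResolventKernel (Fib proj_zsmul quo_zsmul)
open LatticeForm (quo)
open Summit.QuantumFields.BalabanUV.Beta.BorderedHessian (stepScale off_eq_zero_iff_proj blk_eq_quo)
open Summit.QuantumFields.BalabanUV.Beta.DshAn1 (Dsh linSym04At linSym04At_inr_inl)
open Summit.QuantumFields.BalabanUV.Beta.SymShiftedSpread (bhKStepSh)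
open Summit.QuantumFields.BalabanUV.Beta.SymAveragingHessianCounts (symLinKerAt)
open Summit.QuantumFields.BalabanUV.Beta.SymAveragingWardRootedStencils (lin04KerAt_eq_symLinKerAt)
open Summit.QuantumFields.BalabanUV.Beta.SymmetrisedAxialPotential (symLinAvgAt)
open Summit.QuantumFields.BalabanUV.Beta.GAN24.SymLinKernelExpansion (tsum_sum_symLinKerAt_mul)
open Summit.QuantumFields.BalabanUV.Beta.FP.KernelPeriodisationFib (Idx perF perF_apply perZ perZ_apply)
open Summit.QuantumFields.BalabanUV.Beta.FP.KernelPeriodisationFibTrace (tsum_sites_eq_sum_tsum)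
open Summit.QuantumFields.BalabanUV.Beta.FP.TorusGaugeCovarianceCoarse (coarsePt coarsePt_coe)
open Summit.QuantumFields.BalabanUV.Beta.FP.PeriodisedSymBorderIndexWard (bhKStepSh_Dsh_inr_inl)
open Summit.QuantumFields.BalabanUV.Beta.FP.TorusSymGaugeCovariance (summable_bhKStepSh_Dsh_inr_inl_mul)
open Summit.QuantumFields.BalabanUV.Beta.FP.TorusCompositeObjects (towerTorus)
open Summit.QuantumFields.BalabanUV.Beta.FP.TorusCompositeObjectsG (QstepSym compRowsSym compRowsSym_succ)

variable {d : ℕ}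

/-! ## §1 A generic helper of R-5 §1 (PRIVATE local copy — see the header) -/

section Pairing

variable (M : Fin (d + 1) → ℕ) [∀ μ, NeZero (M μ)]

/-- [folklore] (PRIVATE local copy of R-5 `TorusStepInsertionPeriodic.sum_perZ_mul_periodic`, whose module has no farm olean yet; de-duplicate by `import` later)
**THE TORUS PAIRING WITH A PERIODIC FORM IS THE LATTICE PAIRING**: for a kernel `K` whose `(inr μ, inl l)` entries at the first slot `x` are summable against the
`M`-periodic real 1-form `B`, `Σ_{y ∈ pbox M} Σ_l perZ M K x y (inr μ) (inl l) · B l y = Σ'_z Σ_l K x z (inr μ) (inl l) · B l z` (box × period lattice = lattice). -/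
private theorem sum_perZ_mul_periodic (K : MKer (d + 1) (Fib d)) (x : Site (d + 1)) (μ : Fin (d + 1)) (B : Form1 (d + 1) ℝ)
    (hB : ∀ (l : Fin (d + 1)) (y m : Site (d + 1)), B l (translate M y m) = B l y)
    (hK : ∀ l : Fin (d + 1), Summable fun z => K x z (Sum.inr μ) (Sum.inl l) * B l z) :
    ∑ y : ↥(pbox M), ∑ l : Fin (d + 1), perZ M K x (y : Site (d + 1)) (Sum.inr μ) (Sum.inl l) * B l (y : Site (d + 1))
      = ∑' z : Site (d + 1), ∑ l : Fin (d + 1), K x z (Sum.inr μ) (Sum.inl l) * B l z := by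
  set H : Fin (d + 1) → Site (d + 1) → ℝ := fun l z => K x z (Sum.inr μ) (Sum.inl l) * B l z with hH
  have hterm : ∀ (y : ↥(pbox M)) (l : Fin (d + 1)),
      perZ M K x (y : Site (d + 1)) (Sum.inr μ) (Sum.inl l) * B l (y : Site (d + 1))
        = ∑' m : Site (d + 1), H l (translate M (y : Site (d + 1)) m) := fun y l => by
    rw [perZ_apply, ← tsum_mul_right]
    refine tsum_congr fun m => ?_
    simp only [hH]
    rw [hB]
  calc ∑ y : ↥(pbox M), ∑ l : Fin (d + 1), perZ M K x (y : Site (d + 1)) (Sum.inr μ) (Sum.inl l) * B l (y : Site (d + 1))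
      = ∑ y : ↥(pbox M), ∑ l : Fin (d + 1), ∑' m : Site (d + 1), H l (translate M (y : Site (d + 1)) m) :=
        Finset.sum_congr rfl fun y _ => Finset.sum_congr rfl fun l _ => hterm y l
    _ = ∑ l : Fin (d + 1), ∑ y : ↥(pbox M), ∑' m : Site (d + 1), H l (translate M (y : Site (d + 1)) m) := Finset.sum_comm
    _ = ∑ l : Fin (d + 1), ∑' z : Site (d + 1), H l z := Finset.sum_congr rfl fun l _ => (tsum_sites_eq_sum_tsum M (hK l)).symm
    _ = ∑' z : Site (d + 1), ∑ l : Fin (d + 1), H l z := (Summable.tsum_finsetSum fun l _ => hK l).symm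

end Pairing

/-! ## §2 The sym one-step rows on periodic forms -/

section Step

variable (Lc : ℕ) [NeZero Lc] (M : Fin (d + 1) → ℕ) [∀ μ, NeZero (M μ)]

/-- [folklore] leaf-06's sym one-step rows entrywise: `QstepSym Lc M ℓ (x, κ) q = perZ (fine Lc M) (bhKStepSh d Lc (Dsh Lc) ℓ) (Lc•x) q.1 (inr κ) (inl q.2)` (unfolding +
`perF_apply` + `coarsePt_coe`). -/
theorem QstepSym_apply (ℓ : ℕ) (x : ↥(pbox M)) (κ : Fin (d + 1)) (q : ↥(pbox (fine Lc M)) × Fin (d + 1)) :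
    QstepSym Lc M ℓ (x, κ) q = perZ (fine Lc M) (bhKStepSh d Lc (Dsh Lc) ℓ) ((Lc : ℤ) • (x : Site (d + 1))) (q.1 : Site (d + 1)) (Sum.inr κ) (Sum.inl q.2) := by
  rw [QstepSym, Matrix.submatrix_apply, perF_apply, coarsePt_coe]

omit [NeZero Lc] in
/-- [folklore] **AT A COARSE MULTIPLIER SITE THE `(inr, inl)` ENTRY OF THE SHIFTED SPREAD IS `stepScale · Lc^{d+1} ·` an1's SYMMETRISED LINEAR AVERAGING KERNEL**:
`bhKStepSh d Lc (Dsh Lc) ℓ (Lc•x) z (inr κ) (inl l) = stepScale d Lc ℓ · Lc^{d+1} · symLinKerAt (ctr (d+1) Lc) Lc κ x (l, z)` (`bhKStepSh_Dsh_inr_inl`, `linSym04At_inr_inl`,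
`lin04KerAt_eq_symLinKerAt`, `off Lc (Lc•x) = 0`, `blk Lc (Lc•x) = x`). -/
theorem bhKStepSh_Dsh_zsmul_inr_inl [NeZero Lc] (ℓ : ℕ) (x z : Site (d + 1)) (κ l : Fin (d + 1)) :
    bhKStepSh d Lc (Dsh Lc) ℓ ((Lc : ℤ) • x) z (Sum.inr κ) (Sum.inl l)
      = stepScale d Lc ℓ * ((Lc : ℝ) ^ (d + 1) * symLinKerAt (ctr (d + 1) Lc) Lc κ x (l, z)) := by
  rw [bhKStepSh_Dsh_inr_inl, linSym04At_inr_inl, if_pos ((off_eq_zero_iff_proj _).2 (proj_zsmul (N := Lc) x)), blk_eq_quo, quo_zsmul (N := Lc),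
    lin04KerAt_eq_symLinKerAt]

/-- [folklore] **`sum_QstepSym_mul_periodic` — THE (0.4)-SYMMETRISED ONE-STEP ROWS ACT ON `fine Lc M`-PERIODIC 1-FORMS AS `stepScale · Lc^{d+1} ·` THE
`symLinKerAt`-PAIRING AT THE CENTRED ROOT** (kernel form; the sym twin of R-1 §1 `sum_Qstep_mul_periodic`):
`Σ_q QstepSym Lc M ℓ (x, κ) q · B q.2 q.1 = stepScale d Lc ℓ · Lc^{d+1} · Σ'_z Σ_l symLinKerAt (ctr (d+1) Lc) Lc κ x (l, z) · B l z` (every sum finite). -/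
theorem sum_QstepSym_mul_periodic (ℓ : ℕ) (B : Form1 (d + 1) ℝ) (hB : ∀ (l : Fin (d + 1)) (y m : Site (d + 1)), B l (translate (fine Lc M) y m) = B l y)
    (x : ↥(pbox M)) (κ : Fin (d + 1)) :
    ∑ q : ↥(pbox (fine Lc M)) × Fin (d + 1), QstepSym Lc M ℓ (x, κ) q * B q.2 (q.1 : Site (d + 1))
      = stepScale d Lc ℓ * ((Lc : ℝ) ^ (d + 1)
          * ∑' z : Site (d + 1), ∑ l : Fin (d + 1), symLinKerAt (ctr (d + 1) Lc) Lc κ (x : Site (d + 1)) (l, z) * B l z) := by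
  have step := sum_perZ_mul_periodic (fine Lc M) (bhKStepSh d Lc (Dsh Lc) ℓ) ((Lc : ℤ) • (x : Site (d + 1))) κ B hB
    (fun l => summable_bhKStepSh_Dsh_inr_inl_mul ℓ _ κ l (B l))
  calc ∑ q : ↥(pbox (fine Lc M)) × Fin (d + 1), QstepSym Lc M ℓ (x, κ) q * B q.2 (q.1 : Site (d + 1))
      = ∑ y : ↥(pbox (fine Lc M)), ∑ l : Fin (d + 1),
          perZ (fine Lc M) (bhKStepSh d Lc (Dsh Lc) ℓ) ((Lc : ℤ) • (x : Site (d + 1))) (y : Site (d + 1)) (Sum.inr κ) (Sum.inl l) * B l (y : Site (d + 1)) := by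
        rw [Fintype.sum_prod_type]
        exact Finset.sum_congr rfl fun y _ => Finset.sum_congr rfl fun l _ => by rw [QstepSym_apply]
    _ = ∑' z : Site (d + 1), ∑ l : Fin (d + 1), bhKStepSh d Lc (Dsh Lc) ℓ ((Lc : ℤ) • (x : Site (d + 1))) z (Sum.inr κ) (Sum.inl l) * B l z := step
    _ = ∑' z : Site (d + 1), (stepScale d Lc ℓ * (Lc : ℝ) ^ (d + 1)) * ∑ l : Fin (d + 1), symLinKerAt (ctr (d + 1) Lc) Lc κ (x : Site (d + 1)) (l, z) * B l z := by
        refine tsum_congr fun z => ?_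
        rw [Finset.mul_sum]
        exact Finset.sum_congr rfl fun l _ => by rw [bhKStepSh_Dsh_zsmul_inr_inl]; ring
    _ = stepScale d Lc ℓ * ((Lc : ℝ) ^ (d + 1)
          * ∑' z : Site (d + 1), ∑ l : Fin (d + 1), symLinKerAt (ctr (d + 1) Lc) Lc κ (x : Site (d + 1)) (l, z) * B l z) := by
        rw [tsum_mul_left, mul_assoc]

/-- [folklore] **… = `(stepScale d Lc ℓ ∕ (d+1)!) · symLinAvgAt (ctr (d+1) Lc) B Lc κ x`** (average form; gan24-leaf-02's `tsum_sum_symLinKerAt_mul` at the centred root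
`ctr (d+1) Lc = toSite (ctrOff (d+1) Lc)`, `rfl`; the `(d+1)!` is the number of comb orders summed in an1's `symLinAvgAt`). -/
theorem sum_QstepSym_mul_periodic_eq_symLinAvgAt (ℓ : ℕ) (B : Form1 (d + 1) ℝ) (hB : ∀ (l : Fin (d + 1)) (y m : Site (d + 1)), B l (translate (fine Lc M) y m) = B l y)
    (x : ↥(pbox M)) (κ : Fin (d + 1)) :
    ∑ q : ↥(pbox (fine Lc M)) × Fin (d + 1), QstepSym Lc M ℓ (x, κ) q * B q.2 (q.1 : Site (d + 1))
      = stepScale d Lc ℓ * ((((d + 1).factorial : ℕ) : ℝ)⁻¹ * symLinAvgAt (ctr (d + 1) Lc) B Lc κ (x : Site (d + 1))) := by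
  have hLc : 1 ≤ Lc := Nat.one_le_iff_ne_zero.mpr (NeZero.ne Lc)
  have hL0 : ((Lc : ℝ) ^ (d + 1)) ≠ 0 := pow_ne_zero _ (Nat.cast_ne_zero.2 (NeZero.ne Lc))
  have hf : ((((d + 1).factorial : ℕ) : ℝ)) ≠ 0 := Nat.cast_ne_zero.2 (Nat.factorial_ne_zero _)
  rw [sum_QstepSym_mul_periodic Lc M ℓ B hB x κ, show ctr (d + 1) Lc = toSite (ctrOff (d + 1) Lc) from rfl,
    tsum_sum_symLinKerAt_mul (ctrOff_mem_box hLc) B κ (x : Site (d + 1))]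
  field_simp

end Step


/-! ## §3 The composite: `compRowsSym … n` acts on periodic forms as ANY functional obeying our top-peeled recursion -/

section Composite

variable (Lc : ℕ) [NeZero Lc]

/-- [folklore] **`sum_compRowsSym_mul_periodic_of_clauses` — leaf-06's (0.4)-SYMMETRISED COMPOSITE ROWS ACT ON PERIODIC 1-FORMS AS ANY LATTICE FUNCTIONAL OBEYING
OUR TOP-PEELED RECURSION** (carrier-free; R-7's architecture at order 0).  Letters: `𝓡 lev n : Form1 → Form1`; `h0` (depth `0` is the identity); `hsucc` (TOP PEEL: the
level-`lev 1` sym one-step kernel functional of §2 applied to the depth-`n` functional of the levels below); `hper` (a form periodic under the finest torus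
`towerTorus Lc T n` is mapped to a `T`-periodic form).  Conclusion, for every `towerTorus Lc M n`-periodic real 1-form `A` and every top bond `(x, κ)`:
`Σ_q compRowsSym Lc M lev rs n (x, κ) q · A q.2 q.1 = 𝓡 lev n A κ x` (the comb-root list `rs` is immaterial — `compRowsSym` ignores it). -/
theorem sum_compRowsSym_mul_periodic_of_clauses (𝓡 : (ℕ → ℕ) → ℕ → Form1 (d + 1) ℝ → Form1 (d + 1) ℝ)
    (h0 : ∀ (lev : ℕ → ℕ) (B : Form1 (d + 1) ℝ), 𝓡 lev 0 B = B)
    (hsucc : ∀ (lev : ℕ → ℕ) (n : ℕ) (B : Form1 (d + 1) ℝ) (κ : Fin (d + 1)) (x : Site (d + 1)),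
      𝓡 lev (n + 1) B κ x = stepScale d Lc (lev 1) * ((Lc : ℝ) ^ (d + 1)
        * ∑' z : Site (d + 1), ∑ l : Fin (d + 1), symLinKerAt (ctr (d + 1) Lc) Lc κ x (l, z) * 𝓡 (fun k => lev (k + 1)) n B l z))
    (hper : ∀ (lev : ℕ → ℕ) (n : ℕ) (T : Fin (d + 1) → ℕ) (B : Form1 (d + 1) ℝ),
      (∀ (l : Fin (d + 1)) (y m : Site (d + 1)), B l (translate (towerTorus Lc T n) y m) = B l y) →
        ∀ (l : Fin (d + 1)) (y m : Site (d + 1)), 𝓡 lev n B l (translate T y m) = 𝓡 lev n B l y) :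
    ∀ (n : ℕ) (M : Fin (d + 1) → ℕ) [∀ μ, NeZero (M μ)] (lev : ℕ → ℕ) (rs : ℕ → (Fin (d + 1) → ℕ)) (A : Form1 (d + 1) ℝ)
      (_ : ∀ (l : Fin (d + 1)) (w t : Site (d + 1)), A l (translate (towerTorus Lc M n) w t) = A l w) (x : ↥(pbox M)) (κ : Fin (d + 1)),
      ∑ q : ↥(pbox (towerTorus Lc M n)) × Fin (d + 1), compRowsSym Lc M lev rs n (x, κ) q * A q.2 (q.1 : Site (d + 1)) = 𝓡 lev n A κ (x : Site (d + 1))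
  | 0, M, _, lev, rs, A, hA, x, κ => by
      rw [h0]
      show ∑ q : ↥(pbox M) × Fin (d + 1), (1 : Matrix (↥(pbox M) × Fin (d + 1)) (↥(pbox M) × Fin (d + 1)) ℝ) (x, κ) q * A q.2 (q.1 : Site (d + 1)) = A κ (x : Site (d + 1))
      rw [Finset.sum_eq_single (x, κ) (fun q _ hq => by rw [Matrix.one_apply_ne (Ne.symm hq), zero_mul]) (fun h => absurd (Finset.mem_univ _) h),
        Matrix.one_apply_eq, one_mul]
  | n + 1, M, _, lev, rs, A, hA, x, κ => by
      have IH := sum_compRowsSym_mul_periodic_of_clauses 𝓡 h0 hsucc hper n (fine Lc M) (fun k => lev (k + 1)) (fun k => rs (k + 1)) A hA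
      -- the lower functional of a finest-periodic form is `fine Lc M`-periodic
      have hB : ∀ (l : Fin (d + 1)) (y m : Site (d + 1)), 𝓡 (fun k => lev (k + 1)) n A l (translate (fine Lc M) y m) = 𝓡 (fun k => lev (k + 1)) n A l y :=
        hper (fun k => lev (k + 1)) n (fine Lc M) A hA
      rw [compRowsSym_succ, hsucc]
      calc ∑ q : ↥(pbox (towerTorus Lc M (n + 1))) × Fin (d + 1),
            (QstepSym Lc M (lev 1) * compRowsSym Lc (fine Lc M) (fun k => lev (k + 1)) (fun k => rs (k + 1)) n) (x, κ) q * A q.2 (q.1 : Site (d + 1))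
          = ∑ p : ↥(pbox (fine Lc M)) × Fin (d + 1), QstepSym Lc M (lev 1) (x, κ) p *
              ∑ q : ↥(pbox (towerTorus Lc M (n + 1))) × Fin (d + 1),
                compRowsSym Lc (fine Lc M) (fun k => lev (k + 1)) (fun k => rs (k + 1)) n p q * A q.2 (q.1 : Site (d + 1)) := by
            simp only [Matrix.mul_apply, Finset.sum_mul, Finset.mul_sum, mul_assoc]
            exact Finset.sum_comm
        _ = ∑ p : ↥(pbox (fine Lc M)) × Fin (d + 1), QstepSym Lc M (lev 1) (x, κ) p * 𝓡 (fun k => lev (k + 1)) n A p.2 (p.1 : Site (d + 1)) := by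
            refine Finset.sum_congr rfl fun p _ => ?_
            obtain ⟨y, l⟩ := p
            exact congrArg (fun t : ℝ => QstepSym Lc M (lev 1) (x, κ) (y, l) * t) (IH y l)
        _ = _ := sum_QstepSym_mul_periodic Lc M (lev 1) (𝓡 (fun k => lev (k + 1)) n A) hB x κ

end Composite

end Summit.QuantumFields.BalabanUV.Beta.FP.TorusCompositeRowsSymPeriodic

end
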